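import Summits.BirchSwinnertonDyer.BirchSwinnertonDyer.Theses.PAdicOrderV2
import Literature.NumberTheory.EllipticCurves.KatoDivisibilitySkeletonProofs

/-!
# Route PAdicOrderV2 — support item `PAdicOrderKatoSideR2` (stmt-BirchSwinnertonDyer-0491):
# what it reduces to inside the route and inside the tree

`Summit.BirchSwinnertonDyer.BirchSwinnertonDyer.Theses.PAdicOrderV2.PAdicOrderKatoSideR2`:
for `E/ℚ` (globally minimal `W`), an odd prime `p` of good ordinary reduction and the newform `f`
of `E`, `rank E(ℚ) ≤ ord_{T=0} L_p(E,T)` in `ℕ∞` (`L_p(E,T) = padicLFunction f (unitRoot W p)`).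
In print this is K. Kato, Astérisque 295 (2004), Thm 18.4 (p. 281), "In particular" clause; in the
tree it is, binder for binder, the universal closure of the named fact
`Literature.NumberTheory.EllipticCurves.kato_mordellWeilRank_le_order_padicLFunction`
(`Theorems/PAdicOrderPAdicOrderKatoSideR2.lean`,
`pAdicOrderV2KatoSideR2_iff_forall_kato_mordellWeilRank_le_order_padicLFunction`), whose one
undischarged input is Kato's divisibility Thm 17.4 (`kato_divisibility`; Beilinson–Kato Euler
system, Coleman map, explicit reciprocity — none of Kato §12–§17 exists in Mathlib or the tree).

This file adds two sorry-free renderings that sharpen the record of WHAT EXACTLY the item waits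
for, one inside the route and one inside the tree:

* `padicOrderV2_katoSideR2_of_padicBSDrankR2` — inside the route: the support item is implied by
  crux #3 `PAdicOrderPadicBSDrankR2` (rank clause (i) of the Mazur–Tate–Teitelbaum conjecture,
  `ord_{T=0} L_p(E,T) = rank E(ℚ)` at every good ordinary `p`): an equality is an inequality. So
  the item is not an independent obligation of the route — it closes the moment crux #3 does.
* `padicOrderV2_katoSideR2_of_thm17_4` — inside the tree: the item follows from conclusions
  (1)–(2) of Kato's Thm 17.4 ALONE, on ONE cyclotomic datum per `(E, p, f)` — `X(E/ℚ_∞)` is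
  `Λ`-torsion and `p^n L_p(E,T) = ι g` for some `g ∈ char_Λ X(E/ℚ_∞)` — through the tree theorem
  `Literature.NumberTheory.EllipticCurves.kato_mordellWeilRank_le_order_padicLFunction_of_thm17_4`
  (`rank E(ℚ) ≤ rank_{ℤ_p} X/TX ≤ ord_T g ≤ ord_T ι g = ord_T L_p`; Greenberg LNM 1716 Lemma 3.1 and
  p. 65). This is strictly weaker than the tree's named fact `kato_divisibility` (which also
  carries the integral refinement (3) and quantifies over all data `(κ, γ, D)`), and it is the
  minimal missing input: the hypothesis below is precisely the output of
  `Kato2004.kato_divisibility_conclusions_of_skeleton` (file `KatoDivisibilitySkeletonProofs`),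
  i.e. of Kato's four cohomological inputs of §17.13.

Both are CONDITIONAL renderings (the first on an open crux, the second on Kato Thm 17.4 (1)–(2));
neither closes the item, which stays open until `kato_divisibility` (equivalently, for this item,
`kato_mordellWeilRank_le_order_padicLFunction`) is discharged.
-/

-- D-0017: single-problem summit, so `Summit.BirchSwinnertonDyer.BirchSwinnertonDyer.…` repeats a
-- namespace BY DESIGN (the `Summits` lib sets this option in `lakefile.toml`; repeated for standalone checks).
set_option linter.dupNamespace false

namespace Summit.BirchSwinnertonDyer.BirchSwinnertonDyer.Theorems

open scoped MatrixGroups ModularForm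
open CongruenceSubgroup Literature.NumberTheory.EllipticCurves
  Literature.NumberTheory.EllipticCurves.ModularForms
open Summit.BirchSwinnertonDyer.BirchSwinnertonDyer.Theses.PAdicOrderV2

/-- **The Kato side is implied by crux #3 of the route.** If `ord_{T=0} L_p(f,α_p,T) = rank_ℤ E(ℚ)`
at every good ordinary prime `p` and for every newform `f` of `E` (`PAdicOrderPadicBSDrankR2`,
item stmt-BirchSwinnertonDyer-0490 = rank clause (i) of the Mazur–Tate–Teitelbaum conjecture
BSD(p), Mazur–Tate–Teitelbaum 1986 §II.10), then in particular `rank_ℤ E(ℚ) ≤ ord_{T=0} L_p` at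
every odd good ordinary prime (`PAdicOrderKatoSideR2`, item stmt-BirchSwinnertonDyer-0491): an
equality in `ℕ∞` gives the inequality. Pure logic; records that the support item is not an
independent obligation of route PAdicOrderV2. [folklore] -/
theorem padicOrderV2_katoSideR2_of_padicBSDrankR2 (h : PAdicOrderPadicBSDrankR2) :
    PAdicOrderKatoSideR2 := by
  intro W _ _ p _ _hp hord N _ f hf
  exact (h W p hord f hf).symm.le

/-- **`PAdicOrderKatoSideR2` from Kato's Thm 17.4 (1)–(2) on one cyclotomic datum.** Suppose that
for every elliptic `E/ℚ` (globally minimal `W`), every odd good ordinary prime `p` and every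
newform `f` of `E` there are a cyclotomic `ℤ_p`-extension `κ` of `ℚ`, a topological generator `γ`
of `Γ = Gal(ℚ_∞/ℚ)` and a Pontryagin-dual datum `D` for `Sel_{p^∞}(E/ℚ_∞)` such that `D.X` is
`Λ`-torsion and `p^n L_p(E,T) = ι g` for some `n` and some `g ∈ char_Λ D.X` (K. Kato, Astérisque
295 (2004), Thm 17.4 (1)–(2), p. 273, for `T = T_pE(-1)`). Then `rank E(ℚ) ≤ ord_{T=0} L_p(E,T)`
at every odd good ordinary prime, i.e. the route decl holds. The derivation is the tree theorem
`Literature.NumberTheory.EllipticCurves.kato_mordellWeilRank_le_order_padicLFunction_of_thm17_4`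
(`rank E(ℚ) ≤ rank_{ℤ_p} X/TX` by Greenberg's Lemma 3.1 and Pontryagin evaluation of Kummer
classes, `rank_{ℤ_p} X/TX ≤ ord_T g` by the structure-theorem inequality, `ord_T g ≤ ord_T ι g =
ord_T (p^n L_p) = ord_T L_p`); Kato 2004 §18.5–18.10, Greenberg LNM 1716 Lemma 3.1 and p. 65. The
hypothesis is exactly the conclusion of `Kato2004.kato_divisibility_conclusions_of_skeleton`, so
what separates this item from a proof is Kato's four cohomological inputs of §17.13 (Poitou–Tate
sequence (17.13.1), Thm 12.4, Prop 17.11 with Thm 16.6, Thm 12.5 (3)) for `T_pE(-1)` on one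
cyclotomic datum, and nothing else. CONDITIONAL on that hypothesis.
[cite: Kato2004, Thm 17.4 (p. 273) and Thm 18.4 (p. 281)] -/
theorem padicOrderV2_katoSideR2_of_thm17_4
    (h : ∀ (W : WeierstrassCurve ℚ) [W.IsElliptic] [W.IsGloballyMinimal] (p : ℕ) [Fact p.Prime]
      {N : ℕ} [NeZero N] (f : CuspForm (Gamma0 N) 2),
      p ≠ 2 → IsOrdinaryAt W p → IsNewformOf W f →
        ∃ (κ : ZpExtension ℚ p) (γ : Field.absoluteGaloisGroup ℚ) (D : W.SelmerDualData κ γ),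
          κ.IsCyclotomic ∧ κ.IsTopGenerator γ ∧ D.IsTorsion ∧
          ∃ (n : ℕ) (g : IwasawaAlgebra p), g ∈ D.charIdeal ∧
            iwasawaToPowerSeries p g =
              PowerSeries.C ((p : ℚ_[p]) ^ n) * padicLFunction f (unitRoot W p : ℚ_[p])) :
    PAdicOrderKatoSideR2 := by
  intro W _ _ p _ hp hord N _ f hf
  exact kato_mordellWeilRank_le_order_padicLFunction_of_thm17_4 W p (h W p f) hp hord hf

end Summit.BirchSwinnertonDyer.BirchSwinnertonDyer.Theorems
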